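/-
Copyright (c) 2026 the pub-hodgecm-mathlib formalisation cell (harness21).  Prover seat hodgecm-mathlib-K2E3-p37 (g3), Track B «K2-LIT»,
#184♮ = hLiu418 = `stmt-HodgeConjecture-24832`; socket #41 `sig_K2LiuSiegelEisensteinContinuation`, KIND W, brick (iii-fin-Φ5): the per-place Φ5 stability ∕
differentiability letters `hsd` of ★ `K2LiuKindWFiniteLetterOfReading.hFfin_of_reading` (LEAD F0P6-plan (g15) BATCH #183 (4); KW desk F0P2-p08 (g3) ruling 00:28:58Z:
the det guard `(S : Matrix (Fin 2) (Fin 2) L).det ≠ 0 →`).  THEOREMS ONLY (no `def`, no `instance`, no notation, no named-fact hypothesis, no `sorry`).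
-/
import Summits.HodgeConjecture.HodgeConjecture.Theorems.K2LiuKindWFiniteLetterOfReading   -- ★ (iii-fin-read) (+ ★ (x-a-int-fac) `kindWFvT_mem_localDegPS`, ★ (iii-fin) `kindWLocalBall`, ★ (E6′) flat families)
import Summits.HodgeConjecture.HodgeConjecture.Theorems.K2LiuKindWGoodPlaceFactor          -- ★ (KW-J) `beta_skew`, `beta_mul_betaInv` (+ ★ glue `skewCarrier_measure_letters`, ★ B4 `evalPlace_finPart_weylDelta`, ★ B2, ★ B3)
import Summits.HodgeConjecture.HodgeConjecture.Theorems.K2LiuBadPlaceLocalFactorSkew       -- ★ `integral_unipDeltaLoc_eq_integral_skew_tate`, `exists_hasConductorExp_adeleAddCharAt` (+ ★ Φ5-tie, ★ F3b)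
import Summits.HodgeConjecture.HodgeConjecture.Theorems.K2LiuRankOneCentreContinuation     -- ★ `differentiable_siegelDeltaCharacter`
import Literature.NumberTheory.GaloisRepresentations.HeckeCharacterConductorExponentProofs  -- ★ `HeckeCharacter.exists_isTrivialOnHigherUnitsAt` (Tate: `χ_w` has a conductor)
import Literature.NumberTheory.GelbartRogawski1991.DoubledWeilRepresentationArchLagrangian  -- ★ `isUnit_det_gramR₀`
import HarnessLib

/-!
# Crux `HLiu418`, socket #41, KIND W — brick (iii-fin-Φ5) `K2LiuKindWFiniteStabilityLetters`: THE PER-PLACE Φ5 LETTERS `hsd` OF ★ `hFfin_of_reading`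
# (stability of the ball integrals beyond one exponent for EVERY `s`, and holomorphy of the stable ball integral), for the (KW-fac) reading, `det S ≠ 0`

Cell `hodgecm-mathlib`, crux item hLiu418 = `stmt-HodgeConjecture-24832` (helper lane `--supports … --as helper`, count-neutral), route of record
`HCCMUnconditional`; squad K2 ∕ K2Liu, road `K2_Liu`, socket #41, KIND W; KW desk of record F0P2-p08 (g3).  ★ (iii-fin-read) `hFfin_of_reading` (F0P2-p08, p863564) takes BY
VALUE, at every `v ∈ kindWFinset T₀ ↑S h`, the letter `hsd : ∃ K, hstable ∧ hdiff` — the ball integrals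
`I_k(s) := ∫_{kindWLocalBall v ϖ_v (−k)} conj ψ_S(ι_v y) · FvT j S h v s ((w_Δ)_v · y · h_v) dν_v(y)` are STABLE (`I_k(s) = I_K(s)` for `k ≥ K`, EVERY `s`) and `s ↦ I_K(s)`
is ENTIRE.  THIS FILE pays it for the (KW-fac) reading of the local factors (`hread`: flat twists `H_v^{2(s−s₀)}·b_{j,v}` above `S₀`, the spherical `Λ_{s,v}` off `S₀`)
under the det guard `det S ≠ 0` of the KW desk's ED. 2 (at a singular `S` the index block `β = −½(S⊗1)` has no inverse and Karel's lemma does not apply):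
* §1 (generic) **`exists_uniform_bound_of_forall_mul_eq`** — a family with ONE open level and `s ↦ f s g` continuous is locally-in-`s` uniformly bounded on a compact
  set (finite coset cover) = ★ Φ5's `hbd`; **`exists_nhds_localComponent_eq_one`** — the local components of a Hecke character are trivial near `1` = ★ Φ5's `hχv`
  (★ Lit `HeckeCharacter.exists_isTrivialOnHigherUnitsAt`, Tate's conductor).
* §2 (one place `v` of the K2Lit CM datum, `n = 2`) **`setIntegral_kindWLocalBall_eq_setIntegral_skew_tate`** — the SET version of ★ `integral_unipDeltaLoc_eq_integral_skew_tate`: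
  the `kindWLocalBall`-integral IS the Skew-ball integral of ★ Φ5's integrand; HEAD **`exists_setIntegral_kindWLocalBall_stable_and_differentiable`** — for a family of
  local Siegel sections with ONE open level (`hfU : ∀ s g k, k ∈ U → f s (g * k) = f s g`, ★ (ρ7) ∕ ★ Φ5 currency) and `s ↦ f s g` entire, `det S ≠ 0`, any right
  translate `g₀`: `∃ K : ℕ, hstable ∧ hdiff` — ★ Φ5 `whittaker_setIntegral_ball_eq` + `differentiable_whittaker` at `(L⁺, L, δ = imagUnit L, 2, gramR, hermD)` with every
  letter discharged (★ `isUnit_det_gramR₀`; Tate's `ψ_{L⁺,v}` and its conductor; ★ B3's trace; ★ `exists_skewUnit` ∕ `exists_two_threshold` ∕ `exists_mball_neg`; ★ (KW-J)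
  `beta_skew` ∕ `beta_mul_betaInv`; ★ glue `skewCarrier_measure_letters`; §1).
* §3 (★ p863564's variable block verbatim) **`hsd_of_level_of_det_ne_zero`** — the guarded `hsd` from the level ∕ holomorphy LETTERS of the factors (`hlev`, `hdiffp`), and
  **`hsd_of_isStd_of_det_ne_zero`** — the same with those letters DISCHARGED for the (KW-fac) reading under `𝒦.IsStd` (★ (E6′) `heightLoc_mul_of_mem`,
  `isOpen_coe_comap_locToAdelic`, `differentiable_heightTwist`, ★ Lit `lambdaLoc_mul_localInt`, ★ `differentiable_siegelDeltaCharacter`).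
[KudlaRallis1994, §2] [Shimura1997, §18.3–18.4] [Casselman1980, §3] [TateThesis1967, §2.3].
HONEST LABEL.  Count-neutral helper; closes no socket by itself: `HC_CM` is proved only modulo the 7 printed citations (2 remaining named inputs:
hLiu418 = `stmt-HodgeConjecture-24832`, h413 = `stmt-HodgeConjecture-24833`) until rung 0 closes.  NOT HERE: the singular indices `det S = 0` (guarded out by the desk's ED. 2).

## References
* [KudlaRallis1994] S. Kudla, S. Rallis, Ann. of Math. 140 (1994): §2.   * [Shimura1997] G. Shimura, CBMS 93 (1997): §18.3–18.4.
* [Casselman1980] W. Casselman, Compositio Math. 40 (1980): §3.   * [TateThesis1967] J. Tate, in Cassels–Fröhlich (1967): §2.3 (conductor of a quasi-character).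
* [HarrisKudlaSweet1996] M. Harris, S. Kudla, W. Sweet, J. AMS 9 (1996): §1 (1.15) (smooth Siegel sections).
-/

set_option autoImplicit false
-- the mandated namespace repeats the single-problem summit's segment (`HodgeConjecture.HodgeConjecture`)
set_option linter.dupNamespace false

noncomputable section

open scoped Matrix ComplexConjugate NNReal ENNReal Topology
open NumberField IsDedekindDomain Matrix MeasureTheory Measure Set Filter Metric
open Literature.NumberTheory.Automorphic hiding IsKFinite
open Literature.NumberTheory.Automorphic.UnitaryGroup Literature.NumberTheory.GaloisRepresentations
open Literature.NumberTheory.LFunctions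
open Literature.NumberTheory.GelbartRogawski1991 Literature.NumberTheory.GelbartRogawski1991.GRConstruction
open Literature.NumberTheory.GelbartRogawski1991.AdaptedBlocks
open Literature.NumberTheory.GelbartRogawski1991.UnitaryDualPair Literature.NumberTheory.GelbartRogawski1991.UnitaryDualPair.LocalSplitting
open Literature.NumberTheory.K2Lit Literature.NumberTheory.K2Lit.SiegelDoubled Literature.NumberTheory.K2Lit.LocalSiegelDoubled Literature.NumberTheory.K2Lit.PlaceSplitting
open Summit.HodgeConjecture.HodgeConjecture.Cruxes.HLiu418.K2LiuSiegelUnipotentFourierDefs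
open Summit.HodgeConjecture.HodgeConjecture.Cruxes.HLiu418.K2LiuSiegelUnipotentLocalDefs
open Summit.HodgeConjecture.HodgeConjecture.Cruxes.HLiu418.K2LiuSiegelUnipotentSplitDefs
open Summit.HodgeConjecture.HodgeConjecture.Cruxes.HLiu418.K2LiuSiegelEisensteinKindWLetters
open Summit.HodgeConjecture.HodgeConjecture.Cruxes.HLiu418.K2LiuUnipDeltaLocBridge
open Summit.HodgeConjecture.HodgeConjecture.Cruxes.HLiu418.K2LiuUnipDeltaLocalCoordinates (blkB_matA_nElem)
open Summit.HodgeConjecture.HodgeConjecture.Cruxes.HLiu418.K2LiuUnipDeltaLocalHaarTransport (exists_homeomorph_skew_of_carrier)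
open Summit.HodgeConjecture.HodgeConjecture.Cruxes.HLiu418.K2LiuLocalRingValuationBalls (mball_antitone)
open Summit.HodgeConjecture.HodgeConjecture.Cruxes.HLiu418.K2LiuBadPlaceWhittakerData (exists_mball_neg exists_two_threshold exists_skewUnit)
open Summit.HodgeConjecture.HodgeConjecture.Cruxes.HLiu418.K2LiuSkewLatticeShells
open Summit.HodgeConjecture.HodgeConjecture.Cruxes.HLiu418.K2LiuBadPlaceWhittakerEntire (whittaker_setIntegral_ball_eq differentiable_whittaker)
open Summit.HodgeConjecture.HodgeConjecture.Cruxes.HLiu418.K2LiuBadPlaceLocalFactorSkew (integral_unipDeltaLoc_eq_integral_skew_tate exists_hasConductorExp_adeleAddCharAt)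
open Summit.HodgeConjecture.HodgeConjecture.Cruxes.HLiu418.K2LiuLocalWhittakerFactorSkew (evalPlace_finPart_weylDelta)
open Summit.HodgeConjecture.HodgeConjecture.Cruxes.HLiu418.K2LiuTateCharacterLocalTrace
open Summit.HodgeConjecture.HodgeConjecture.Cruxes.HLiu418.K2LiuGoodPlaceLocalFactor (skewCarrier_measure_letters)
open Summit.HodgeConjecture.HodgeConjecture.Cruxes.HLiu418.K2LiuKindWGoodPlaceFactor (beta_skew beta_mul_betaInv)
open Summit.HodgeConjecture.HodgeConjecture.Cruxes.HLiu418.K2LiuStdFamilyAwayPurityFlat (heightLoc_mul_of_mem isOpen_coe_comap_locToAdelic differentiable_heightTwist)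
open Summit.HodgeConjecture.HodgeConjecture.Cruxes.HLiu418.K2LiuRankOneCentreContinuation (differentiable_siegelDeltaCharacter)
open Summit.HodgeConjecture.HodgeConjecture.Cruxes.HLiu418.K2LiuKindWFactorLetters (kindWFvT_mem_localDegPS)
open Summit.HodgeConjecture.HodgeConjecture.Cruxes.HLiu418.K2LiuKindWFiniteLetterDefs (kindWLocalBall isOpen_kindWLocalBall)

namespace Summit.HodgeConjecture.HodgeConjecture.Cruxes.HLiu418.K2LiuKindWFiniteStabilityLetters

/-! ## §1 Generic: one open level ⇒ locally uniform bounds on compacta; local components of a Hecke character are trivial near `1` -/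

/-- **ONE OPEN LEVEL ⇒ LOCALLY UNIFORM BOUND ON A COMPACT SET** (★ Φ5's letter `hbd`): if `f s` is right-`U`-invariant for an open subgroup `U` (the same for every
`s`) and `s ↦ f s g` is continuous for every `g`, then on a compact `C` the family is bounded uniformly in `g ∈ C` and `s` in a disc: cover `C` by finitely many
cosets `gᵢU` and bound the finitely many continuous `s ↦ f s gᵢ` on the closed unit disc. [cite: HarrisKudlaSweet1996, §1 (1.15)] [cite: Casselman1980, §3] -/
theorem exists_uniform_bound_of_forall_mul_eq {G : Type*} [Group G] [TopologicalSpace G] [IsTopologicalGroup G]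
    {U : Subgroup G} (hU : IsOpen (U : Set G)) {f : ℂ → G → ℂ} (hfU : ∀ s g k, k ∈ U → f s (g * k) = f s g)
    (hcont : ∀ g, Continuous fun s => f s g) {C : Set G} (hC : IsCompact C) (s₀ : ℂ) :
    ∃ r > 0, ∃ B : ℝ, ∀ s ∈ ball s₀ r, ∀ g ∈ C, ‖f s g‖ ≤ B := by
  classical
  obtain ⟨t, -, htC⟩ := hC.elim_nhds_subcover (fun g => (fun k => g * k) '' (U : Set G)) fun g _ =>
    ((Homeomorph.mulLeft g).isOpenMap _ hU).mem_nhds ⟨1, U.one_mem, mul_one g⟩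
  have hbd : ∀ g : G, ∃ B : ℝ, ∀ s ∈ closedBall s₀ 1, ‖f s g‖ ≤ B := fun g =>
    (isCompact_closedBall s₀ 1).exists_bound_of_continuousOn (hcont g).continuousOn
  choose B hB using hbd
  refine ⟨1, one_pos, ∑ g ∈ t, |B g|, fun s hs g hg => ?_⟩
  obtain ⟨g₁, hg₁, hgg₁⟩ := Set.mem_iUnion₂.1 (htC hg)
  obtain ⟨k, hk, rfl⟩ := hgg₁
  rw [hfU s g₁ k hk]
  calc ‖f s g₁‖ ≤ B g₁ := hB g₁ s (ball_subset_closedBall hs)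
    _ ≤ |B g₁| := le_abs_self _
    _ ≤ ∑ g ∈ t, |B g| := Finset.single_le_sum (f := fun g => |B g|) (fun g _ => abs_nonneg (B g)) hg₁

/-- **THE LOCAL COMPONENTS OF A HECKE CHARACTER ARE TRIVIAL NEAR `1`** (★ Φ5's letter `hχv`): `χ_w(x) = 1` on the congruence ball `1 + 𝔭_w^{f+1}` for a conductor
exponent `f` of `χ_w` (★ Lit `HeckeCharacter.exists_isTrivialOnHigherUnitsAt`; an `x` with `|x − 1|_w < 1` is a unit of `𝒪_w`). [cite: TateThesis1967, §2.3] -/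
theorem exists_nhds_localComponent_eq_one {K : Type} [Field K] [NumberField K] (χ : HeckeCharacter K) (w : HeightOneSpectrum (𝓞 K)) :
    ∃ V ∈ 𝓝 (1 : w.adicCompletion K), ∀ x ∈ V, ∀ hx : IsUnit x, χ.localComponent w hx.unit = 1 := by
  obtain ⟨f, hf⟩ := χ.exists_isTrivialOnHigherUnitsAt w
  refine ⟨{x | x - 1 ∈ primePowBall (w.adicCompletion K) ((f + 1 : ℕ) : ℤ)}, ?_, fun x hx hxu => ?_⟩
  · have hc : Continuous fun x : w.adicCompletion K => x - 1 := continuous_id.sub continuous_const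
    have h0 : primePowBall (w.adicCompletion K) ((f + 1 : ℕ) : ℤ) ∈ 𝓝 ((1 : w.adicCompletion K) - 1) := by
      rw [sub_self]
      exact primePowBall_mem_nhds_zero _
    exact hc.continuousAt.preimage_mem_nhds h0
  · have hx' : Valued.v (x - 1) ≤ WithZero.exp (-((f + 1 : ℕ) : ℤ)) := (mem_primePowBall_adicCompletion_iff w).1 hx
    have hlt : Valued.v (x - 1) < 1 := by
      refine lt_of_le_of_lt hx' ?_
      rw [← WithZero.exp_zero]
      exact WithZero.exp_lt_exp.2 (by omega)
    have hvx : Valued.v x = 1 := by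
      have h := Valuation.map_one_add_of_lt Valued.v hlt
      rwa [add_sub_cancel] at h
    have hx0 : x ≠ 0 := fun h => by
      rw [h, map_zero] at hvx
      exact zero_ne_one hvx
    have hxint : x ∈ w.adicCompletionIntegers K := (HeightOneSpectrum.mem_adicCompletionIntegers _ _ _).2 hvx.le
    have hxinv : x⁻¹ ∈ w.adicCompletionIntegers K := by
      rw [HeightOneSpectrum.mem_adicCompletionIntegers, map_inv₀, hvx, inv_one]
    set u : (w.adicCompletionIntegers K)ˣ :=
      ⟨⟨x, hxint⟩, ⟨x⁻¹, hxinv⟩, Subtype.ext (mul_inv_cancel₀ hx0), Subtype.ext (inv_mul_cancel₀ hx0)⟩ with hu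
    have h1 := hf u (hx'.trans (WithZero.exp_le_exp.2 (by omega)))
    have heq : Units.map ((w.adicCompletionIntegers K).subtype : _ →* _) u = hxu.unit := Units.ext rfl
    rw [heq] at h1
    exact h1

/-! ## §2 One place of the K2Lit CM datum: the `kindWLocalBall`-integrals are ★ Φ5's Skew-ball integrals; Karel's lemma and holomorphy -/

section OnePlace

variable (L : Type) [Field L] [NumberField L] [IsCMField L]
variable {N M : ℕ} (e : Fin N × Fin M ≃ Fin 2)
  (dV : Fin N → L) (hdV : ∀ i, IsCMField.complexConj L (dV i) = dV i)
  (dW : Fin M → L) (hdW : ∀ i, IsCMField.complexConj L (dW i) = dW i)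
  (hdV0 : ∀ i, dV i ≠ 0) (hdW0 : ∀ i, dW i ≠ 0)
  (v : HeightOneSpectrum (𝓞 (Fp L))) {π : v.adicCompletion (Fp L)} (hπ : Valued.v π = WithZero.exp (-1 : ℤ))
  [MeasurableSpace ↥(unipDeltaLoc L e dV hdV dW hdW v)] [BorelSpace ↥(unipDeltaLoc L e dV hdV dW hdW v)]

include hπ in
set_option maxHeartbeats 400000 in -- MEASURED: 200 000 ✗ (`isDefEq` ∕ pending-mvar synthesis on the K2Lit datum's binder telescope under `↥(unipDeltaLoc v) ≤ H(L⁺_v)`, ★ B4's class) ∕ 400 000 ✓; scoped 2×, plain `rw`∕`refine`, no search tactics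
/-- **THE `kindWLocalBall`-INTEGRAL IS THE SKEW-BALL INTEGRAL** (set version of ★ `integral_unipDeltaLoc_eq_integral_skew_tate`): for every `g : H(L⁺_v) → ℂ` and exponent `a`,
`∫_{kindWLocalBall v π a} conj ψ_S(ι_v y)·g(y) dν(y) = ∫_{B_Sk(a)} g(n(t))·ψ_{L⁺,v}(−Tr tr(β t)) d(ψc_*ν)(t)`, `β = −⅟2•(S⊗1)` — `kindWLocalBall v π a` is the `ψc`-preimage of
★ F3b's ball `B_Sk(a)` (★ B2 `(ψc u).1 = B(matA u)`, ★ `blkB_matA_nElem`), so both sides are ★ B4-Tate applied to `1_{B(a)}·g`. [cite: Shimura1997, §18.3] [cite: Casselman1980, §3] -/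
theorem setIntegral_kindWLocalBall_eq_setIntegral_skew_tate (Sk : AddSubgroup (Matrix (Fin 2) (Fin 2) (LocalRing L v)))
    (hSk : ∀ t, t ∈ Sk ↔ (t.map (conjLocal L (IsCMField.complexConj L) v))ᵀ * LocalSplitting.gramS (Fp L) L v 2 (gramR L e dV hdV dW hdW) +
      LocalSplitting.gramS (Fp L) L v 2 (gramR L e dV hdV dW hdW) * t = 0)
    [MeasurableSpace Sk] [BorelSpace Sk] (ψc : ↥(unipDeltaLoc L e dV hdV dW hdW v) ≃ₜ Sk)
    (hψc : ∀ u, (ψc u).1 = blkB (matA (Fp L) L (IsCMField.complexConj L) v 2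
      (u : UnitaryGroup.localPi L (IsCMField.complexConj L) (2 + 2) (hermD L e dV hdV dW hdW) v)))
    (ν : Measure ↥(unipDeltaLoc L e dV hdV dW hdW v)) (S : Matrix (Fin 2) (Fin 2) L)
    (g : UnitaryGroup.localPi L (IsCMField.complexConj L) (2 + 2) (hermD L e dV hdV dW hdW) v → ℂ) (a : ℤ) :
    ∫ y in kindWLocalBall L e dV hdV dW hdW v π a, conj ((unipDeltaChar L e dV hdV dW hdW S (locToAdelic L e dV hdV dW hdW v
        (y : UnitaryGroup.localPi L (IsCMField.complexConj L) (2 + 2) (hermD L e dV hdV dW hdW) v)) : Circle) : ℂ) *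
      g (y : UnitaryGroup.localPi L (IsCMField.complexConj L) (2 + 2) (hermD L e dV hdV dW hdW) v) ∂ν =
    ∫ t in {t : Sk | ∀ i j (w : PlacesOver L v), Valued.v (t.1 i j w) ≤ Valued.v (toPlace v w π) ^ a},
      g (nElem (Fp L) L (IsCMField.complexConj L) v 2 (hermD_eq_map_gramD L e dV hdV dW hdW) t.1 ((hSk t.1).1 t.2)) *
        ((adeleAddCharAt (Fp L) v (-(Algebra.trace (v.adicCompletion (Fp L)) (LocalRing L v)
          (Matrix.trace ((-(⅟(2 : LocalRing L v) • S.map (algebraMap L (LocalRing L v)))) * t.1)))) : Circle) : ℂ) ∂(Measure.map ψc ν) := by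
  -- the ball as a condition on `H(L⁺_v)` through the chart coordinate `B(matA ·)`
  set B : Set (UnitaryGroup.localPi L (IsCMField.complexConj L) (2 + 2) (hermD L e dV hdV dW hdW) v) :=
    {x | ∀ (i j : Fin 2) (w : PlacesOver L v), Valued.v (blkB (matA (Fp L) L (IsCMField.complexConj L) v 2 x) i j w) ≤ Valued.v (toPlace v w π) ^ a} with hB
  have hL : ∫ y in kindWLocalBall L e dV hdV dW hdW v π a, conj ((unipDeltaChar L e dV hdV dW hdW S (locToAdelic L e dV hdV dW hdW v
        (y : UnitaryGroup.localPi L (IsCMField.complexConj L) (2 + 2) (hermD L e dV hdV dW hdW) v)) : Circle) : ℂ) *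
      g (y : UnitaryGroup.localPi L (IsCMField.complexConj L) (2 + 2) (hermD L e dV hdV dW hdW) v) ∂ν =
      ∫ y, conj ((unipDeltaChar L e dV hdV dW hdW S (locToAdelic L e dV hdV dW hdW v
        (y : UnitaryGroup.localPi L (IsCMField.complexConj L) (2 + 2) (hermD L e dV hdV dW hdW) v)) : Circle) : ℂ) *
      B.indicator g (y : UnitaryGroup.localPi L (IsCMField.complexConj L) (2 + 2) (hermD L e dV hdV dW hdW) v) ∂ν := by
    rw [← integral_indicator (isOpen_kindWLocalBall L e dV hdV dW hdW v hπ a).measurableSet]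
    refine integral_congr_ae (Filter.Eventually.of_forall fun y => ?_)
    beta_reduce
    by_cases hy : y ∈ kindWLocalBall L e dV hdV dW hdW v π a
    · have hy' : (y : UnitaryGroup.localPi L (IsCMField.complexConj L) (2 + 2) (hermD L e dV hdV dW hdW) v) ∈ B := hy
      rw [Set.indicator_of_mem hy, Set.indicator_of_mem hy']
    · have hy' : (y : UnitaryGroup.localPi L (IsCMField.complexConj L) (2 + 2) (hermD L e dV hdV dW hdW) v) ∉ B := hy
      rw [Set.indicator_of_notMem hy, Set.indicator_of_notMem hy', mul_zero]
  rw [hL, integral_unipDeltaLoc_eq_integral_skew_tate L e dV hdV dW hdW v Sk hSk ψc hψc ν S (B.indicator g),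
    ← integral_indicator (measurableSet_ball (Fp L) L v hπ 2 Sk a)]
  refine integral_congr_ae (Filter.Eventually.of_forall fun t => ?_)
  beta_reduce
  have hmem : nElem (Fp L) L (IsCMField.complexConj L) v 2 (hermD_eq_map_gramD L e dV hdV dW hdW) t.1 ((hSk t.1).1 t.2) ∈ B ↔
      t ∈ {t : Sk | ∀ i j (w : PlacesOver L v), Valued.v (t.1 i j w) ≤ Valued.v (toPlace v w π) ^ a} := by
    simp only [hB, Set.mem_setOf_eq, blkB_matA_nElem]
  by_cases ht : t ∈ {t : Sk | ∀ i j (w : PlacesOver L v), Valued.v (t.1 i j w) ≤ Valued.v (toPlace v w π) ^ a}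
  · rw [Set.indicator_of_mem ht, Set.indicator_of_mem (hmem.2 ht)]
  · rw [Set.indicator_of_notMem ht, Set.indicator_of_notMem (fun h => ht (hmem.1 h)), zero_mul]

omit [MeasurableSpace ↥(unipDeltaLoc L e dV hdV dW hdW v)] [BorelSpace ↥(unipDeltaLoc L e dV hdV dW hdW v)] in
include hdV0 hdW0 hπ in
set_option maxHeartbeats 1600000 in -- MEASURED: 1 200 000 ✗ (`whnf`) ∕ 1 600 000 ✓ — ★ Φ5's two heads applied at the K2Lit datum (the binder telescope of ★ F4b∕F3b, ×2) + the letters; scoped 8×, plain `have`∕`obtain`∕`exact`, no search tactics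
/-- **KAREL'S LEMMA AND HOLOMORPHY AT THE SKEW CARRIER, ALL LETTERS OF ★ Φ5 DISCHARGED AT THE DATUM.**  At a finite place `v` of `L⁺` (good or bad), on the Skew carrier
`Sk` of ★ F3b with a regular additive Haar measure `μ`: for `f : ℂ → H(L⁺_v) → ℂ` with `f s` a Siegel section of `I_v(s, χ_v)` for every `s`, ONE open level `U`
(`f s (g k) = f s g`, `k ∈ U`, every `s`) and `s ↦ f s g` entire for every `g`, and a skew index `S` with `det S ≠ 0` (`β = −½(S⊗1)`):  there is `K : ℤ` with
`∫_{B(−k)} f s (w_Δ n(t))·ψ_{L⁺,v}(−Tr tr(β t)) dμ = ∫_{B(−K)} (same)` for all `k ≥ K` and EVERY `s`, and `s ↦ ∫_{B(a)} (same)` is `Differentiable ℂ` for every `a` —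
★ Φ5 `whittaker_setIntegral_ball_eq` ∕ `differentiable_whittaker` with: ★ `isUnit_det_gramR₀`; Tate's `ψ_{L⁺,v}` (★ `exists_hasConductorExp_adeleAddCharAt`) and ★ B3's trace;
★ `exists_skewUnit`, `exists_two_threshold`, `exists_mball_neg` (`ε`, `c₂`, the balls of `gramS^{±1}`, `β`, `β⁻¹`); ★ (KW-J) `beta_skew`, `beta_mul_betaInv`; §1 (`hχv`, `hbd`).
[cite: Casselman1980, §3] [cite: KudlaRallis1994, §2] [cite: Shimura1997, §18.3–18.4] -/
theorem exists_setIntegral_skewBall_stable_and_differentiable (Sk : AddSubgroup (Matrix (Fin 2) (Fin 2) (LocalRing L v)))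
    (hSk : ∀ t, t ∈ Sk ↔ (t.map (conjLocal L (IsCMField.complexConj L) v))ᵀ * LocalSplitting.gramS (Fp L) L v 2 (gramR L e dV hdV dW hdW) +
      LocalSplitting.gramS (Fp L) L v 2 (gramR L e dV hdV dW hdW) * t = 0)
    [MeasurableSpace Sk] [BorelSpace Sk] [LocallyCompactSpace Sk] (μ : Measure Sk) [μ.IsAddHaarMeasure] [μ.Regular] (χ : HeckeCharacter L)
    {U : Subgroup (UnitaryGroup.localPi L (IsCMField.complexConj L) (2 + 2) (hermD L e dV hdV dW hdW) v)}
    (hU : IsOpen (U : Set (UnitaryGroup.localPi L (IsCMField.complexConj L) (2 + 2) (hermD L e dV hdV dW hdW) v)))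
    {f : ℂ → UnitaryGroup.localPi L (IsCMField.complexConj L) (2 + 2) (hermD L e dV hdV dW hdW) v → ℂ}
    (hf : ∀ s, IsLocalSiegelSection (Fp L) L (IsCMField.complexConj L) (complexConj_imagUnit L) (imagUnit_ne_zero L) (imagUnit_mul_self L) v 2
      (gramR_isSymm L e dV hdV dW hdW) (hermD_eq_map_gramD L e dV hdV dW hdW) (fun w => χ.localComponent w.1) s (f s))
    (hfU : ∀ s g k, k ∈ U → f s (g * k) = f s g) (hdiff : ∀ g, Differentiable ℂ fun s => f s g)
    (S : ↥(skewMatrices ((IsCMField.complexConj L : L ≃ₐ[Fp L] L) : L →+* L) ((gramR L e dV hdV dW hdW).map (algebraMap (Fp L) L))))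
    (hdet : (S : Matrix (Fin 2) (Fin 2) L).det ≠ 0) :
    ∃ K : ℤ,
      (∀ (s : ℂ) (k : ℤ), K ≤ k →
        ∫ t in {t : Sk | ∀ i j (w : PlacesOver L v), Valued.v (t.1 i j w) ≤ Valued.v (toPlace v w π) ^ (-k)},
          f s (LocalSplitting.weylDelta (Fp L) L (IsCMField.complexConj L) v 2 (hermD_eq_map_gramD L e dV hdV dW hdW) *
              nElem (Fp L) L (IsCMField.complexConj L) v 2 (hermD_eq_map_gramD L e dV hdV dW hdW) t.1 ((hSk t.1).1 t.2)) *
            ((adeleAddCharAt (Fp L) v (-(Algebra.trace (v.adicCompletion (Fp L)) (LocalRing L v)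
              (Matrix.trace ((-(⅟(2 : LocalRing L v) • (S : Matrix (Fin 2) (Fin 2) L).map (algebraMap L (LocalRing L v)))) * t.1)))) : Circle) : ℂ) ∂μ =
        ∫ t in {t : Sk | ∀ i j (w : PlacesOver L v), Valued.v (t.1 i j w) ≤ Valued.v (toPlace v w π) ^ (-K)},
          f s (LocalSplitting.weylDelta (Fp L) L (IsCMField.complexConj L) v 2 (hermD_eq_map_gramD L e dV hdV dW hdW) *
              nElem (Fp L) L (IsCMField.complexConj L) v 2 (hermD_eq_map_gramD L e dV hdV dW hdW) t.1 ((hSk t.1).1 t.2)) *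
            ((adeleAddCharAt (Fp L) v (-(Algebra.trace (v.adicCompletion (Fp L)) (LocalRing L v)
              (Matrix.trace ((-(⅟(2 : LocalRing L v) • (S : Matrix (Fin 2) (Fin 2) L).map (algebraMap L (LocalRing L v)))) * t.1)))) : Circle) : ℂ) ∂μ) ∧
      ∀ a : ℤ, Differentiable ℂ fun s : ℂ =>
        ∫ t in {t : Sk | ∀ i j (w : PlacesOver L v), Valued.v (t.1 i j w) ≤ Valued.v (toPlace v w π) ^ a},
          f s (LocalSplitting.weylDelta (Fp L) L (IsCMField.complexConj L) v 2 (hermD_eq_map_gramD L e dV hdV dW hdW) *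
              nElem (Fp L) L (IsCMField.complexConj L) v 2 (hermD_eq_map_gramD L e dV hdV dW hdW) t.1 ((hSk t.1).1 t.2)) *
            ((adeleAddCharAt (Fp L) v (-(Algebra.trace (v.adicCompletion (Fp L)) (LocalRing L v)
              (Matrix.trace ((-(⅟(2 : LocalRing L v) • (S : Matrix (Fin 2) (Fin 2) L).map (algebraMap L (LocalRing L v)))) * t.1)))) : Circle) : ℂ) ∂μ := by
  haveI : Algebra.IsQuadraticExtension (Fp L) L := IsCMField.isQuadraticExtension L
  letI : MeasurableSpace (v.adicCompletion (Fp L)) := borel _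
  haveI : BorelSpace (v.adicCompletion (Fp L)) := ⟨rfl⟩
  -- the letters at the (possibly bad) place: Tate's character and its conductor, the skew unit `ε`, `c₂`, the Gram exponents, the open kernels of `χ_w`
  obtain ⟨d, hdψ⟩ := exists_hasConductorExp_adeleAddCharAt (Fp L) v
  obtain ⟨ε, hεσ, hεint, cε, hε⟩ := exists_skewUnit (Fp L) L (IsCMField.complexConj L) v hπ (complexConj_imagUnit L) (imagUnit_ne_zero L)
  obtain ⟨c₂, h2⟩ := exists_two_threshold (Fp L) L v hπ
  obtain ⟨b₁, -, hT₁⟩ := exists_mball_neg (Fp L) L v hπ (LocalSplitting.gramS (Fp L) L v 2 (gramR L e dV hdV dW hdW))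
  obtain ⟨b₂, -, hT₂⟩ := exists_mball_neg (Fp L) L v hπ (LocalSplitting.gramS (Fp L) L v 2 (gramR L e dV hdV dW hdW))⁻¹
  have hTb := mball_antitone (Fp L) L v hπ (neg_le_neg (le_max_left b₁ b₂)) hT₁
  have hTib := mball_antitone (Fp L) L v hπ (neg_le_neg (le_max_right b₁ b₂)) hT₂
  have hχv : ∀ w : PlacesOver L v, ∃ V ∈ 𝓝 (1 : w.1.adicCompletion L), ∀ x ∈ V, ∀ hx : IsUnit x, (fun w : PlacesOver L v => χ.localComponent w.1) w hx.unit = 1 :=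
    fun w => exists_nhds_localComponent_eq_one χ w.1
  have hfc : ∀ s, Continuous (f s) := fun s => continuous_of_rightInvariant hU (hfU s)
  -- ★ Φ5-tie: Karel's lemma at the datum (Tate's `ψ_{L⁺,v}`, ★ B3's trace)
  obtain ⟨K₁, hK₁⟩ := whittaker_setIntegral_ball_eq (Fp L) L (IsCMField.complexConj L) (complexConj_imagUnit L) (imagUnit_ne_zero L) (imagUnit_mul_self L)
    v 2 (gramR_isSymm L e dV hdV dW hdW) (isUnit_det_gramR₀ L e dV hdV hdV0 dW hdW hdW0) (hermD_eq_map_gramD L e dV hdV dW hdW) hπ Sk hSk μ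
    MeasureTheory.Measure.addHaar hχv hU hf hfU hfc (ψ := adeleAddCharAt (Fp L) v) (continuous_adeleAddCharAt (Fp L) v) hdψ
    (τ := fun x => Algebra.trace (v.adicCompletion (Fp L)) (LocalRing L v) x)
    (toLocalRing_algebraTrace L v (IsCMField.complexConj L) (complexConj_imagUnit L) (imagUnit_ne_zero L)) (fun r r' => map_add _ r r')
    (algebraTrace_toLocalRing_mul L v) (continuous_algebraTrace_localRing L v) hεσ hεint hε h2 hTb hTib
  -- the index block `β = −½·(S⊗1)`, `β⁻¹ = −2·(S⁻¹⊗1)` (★ (KW-J)) and their balls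
  obtain ⟨b₀, hb₀, hβ₀⟩ := exists_mball_neg (Fp L) L v hπ (-(⅟(2 : LocalRing L v) • (S : Matrix (Fin 2) (Fin 2) L).map (algebraMap L (LocalRing L v))))
  obtain ⟨b', hb', hβinv⟩ := exists_mball_neg (Fp L) L v hπ (-((2 : LocalRing L v) • (S : Matrix (Fin 2) (Fin 2) L)⁻¹.map (algebraMap L (LocalRing L v))))
  have hβb := mball_antitone (Fp L) L v hπ (neg_le_neg (le_max_left b₀ (2 * max b₁ b₂))) hβ₀
  have key := hK₁ (max b₀ (2 * max b₁ b₂)) b' _ _ (hb₀.trans (le_max_left _ _)) hb' (le_max_right _ _)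
    (beta_skew L e dV hdV dW hdW v S) (beta_mul_betaInv L e dV hdV dW hdW v S hdet) hβb hβinv
  refine ⟨K₁ + 4 * max b₀ (2 * max b₁ b₂) + 2 * b' - 1, fun s k hk => key s k hk, fun a => ?_⟩
  -- ★ Φ5-tie: holomorphy, `hbd` by §1 on the compact pull-back of the ball
  refine differentiable_whittaker (Fp L) L (IsCMField.complexConj L) v 2 (hermD_eq_map_gramD L e dV hdV dW hdW) hπ Sk hSk μ hfc hdiff a (fun s₀ => ?_)
    (continuous_adeleAddCharAt (Fp L) v) (continuous_algebraTrace_localRing L v) _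
  obtain ⟨r, hr, B, hB⟩ := exists_uniform_bound_of_forall_mul_eq hU hfU (fun g => (hdiff g).continuous)
    ((isCompact_ball (Fp L) L (IsCMField.complexConj L) v hπ 2 Sk hSk a).image
      (continuous_pullback (Fp L) L (IsCMField.complexConj L) v 2 (hermD_eq_map_gramD L e dV hdV dW hdW) Sk hSk continuous_id)) s₀
  exact ⟨r, hr, B, fun s hs t ht => hB s hs _ (Set.mem_image_of_mem _ ht)⟩

include hdV0 hdW0 hπ in
set_option maxHeartbeats 1600000 in -- MEASURED: 1 200 000 ✗ (`whnf`) ∕ 1 600 000 ✓ — ★ glue's Skew frame at the K2Lit datum (the binder telescope of ★ B2∕B4) + two transports; scoped 8×, plain `have`∕`rw`∕`exact`, no search tactics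
/-- **KAREL'S LEMMA AND HOLOMORPHY FOR THE `kindWLocalBall`-INTEGRALS OF A LEVEL-`U` FAMILY OF LOCAL SIEGEL SECTIONS, `det S ≠ 0`.**  At a finite place `v` of `L⁺`
(good or bad), for `f : ℂ → H(L⁺_v) → ℂ` with `f s` a Siegel section of `I_v(s, χ_v)` for every `s`, ONE open level `U` (`f s (g k) = f s g`, `k ∈ U`, every `s`),
`s ↦ f s g` entire for every `g`, a skew index `S` with `det S ≠ 0` and any right translate `g₀`:  there is `K : ℕ` with
`∫_{kindWLocalBall v π (−k)} conj ψ_S(ι_v y)·f s ((w_Δ)_v·y·g₀) dν = ∫_{kindWLocalBall v π (−K)} (same)` for all `k ≥ K` and EVERY `s`, and `s ↦ ∫_{kindWLocalBall v π (−K)} (same)`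
is `Differentiable ℂ` — `exists_setIntegral_skewBall_stable_and_differentiable` for the translated family `g ↦ f s (g·g₀)` (level `g₀Ug₀⁻¹`) in the Skew frame of ★ B2 ∕ ★ glue
`skewCarrier_measure_letters`, read back through `setIntegral_kindWLocalBall_eq_setIntegral_skew_tate` and ★ B4 `evalPlace_finPart_weylDelta`.
[cite: Casselman1980, §3] [cite: KudlaRallis1994, §2] [cite: Shimura1997, §18.3–18.4] -/
theorem exists_setIntegral_kindWLocalBall_stable_and_differentiable
    (ν : Measure ↥(unipDeltaLoc L e dV hdV dW hdW v)) [ν.IsHaarMeasure] (χ : HeckeCharacter L)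
    {U : Subgroup (UnitaryGroup.localPi L (IsCMField.complexConj L) (2 + 2) (hermD L e dV hdV dW hdW) v)}
    (hU : IsOpen (U : Set (UnitaryGroup.localPi L (IsCMField.complexConj L) (2 + 2) (hermD L e dV hdV dW hdW) v)))
    {f : ℂ → UnitaryGroup.localPi L (IsCMField.complexConj L) (2 + 2) (hermD L e dV hdV dW hdW) v → ℂ}
    (hf : ∀ s, IsLocalSiegelSection (Fp L) L (IsCMField.complexConj L) (complexConj_imagUnit L) (imagUnit_ne_zero L) (imagUnit_mul_self L) v 2
      (gramR_isSymm L e dV hdV dW hdW) (hermD_eq_map_gramD L e dV hdV dW hdW) (fun w => χ.localComponent w.1) s (f s))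
    (hfU : ∀ s g k, k ∈ U → f s (g * k) = f s g) (hdiff : ∀ g, Differentiable ℂ fun s => f s g)
    (S : ↥(skewMatrices ((IsCMField.complexConj L : L ≃ₐ[Fp L] L) : L →+* L) ((gramR L e dV hdV dW hdW).map (algebraMap (Fp L) L))))
    (hdet : (S : Matrix (Fin 2) (Fin 2) L).det ≠ 0)
    (g₀ : UnitaryGroup.localPi L (IsCMField.complexConj L) (2 + 2) (hermD L e dV hdV dW hdW) v) :
    ∃ K : ℕ,
      (∀ (s : ℂ) (k : ℕ), K ≤ k →
        ∫ y in kindWLocalBall L e dV hdV dW hdW v π (-(k : ℤ)),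
          conj (unipDeltaChar L e dV hdV dW hdW (S : Matrix (Fin 2) (Fin 2) L)
              (locToAdelic L e dV hdV dW hdW v
                ((y : ↥(unipDeltaLoc L e dV hdV dW hdW v)) : UnitaryGroup.localPi L (IsCMField.complexConj L) (2 + 2) (hermD L e dV hdV dW hdW) v)) : ℂ) *
            f s (UnitaryGroup.evalPlace (Fp L) L (IsCMField.complexConj L) (2 + 2) (hermD L e dV hdV dW hdW) v
                  (UnitaryGroup.finPart (Fp L) L (IsCMField.complexConj L) (2 + 2) (hermD L e dV hdV dW hdW) (SiegelDoubled.weylDelta L e dV hdV dW hdW)) *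
                ((y : ↥(unipDeltaLoc L e dV hdV dW hdW v)) : UnitaryGroup.localPi L (IsCMField.complexConj L) (2 + 2) (hermD L e dV hdV dW hdW) v) * g₀) ∂ν =
        ∫ y in kindWLocalBall L e dV hdV dW hdW v π (-(K : ℤ)),
          conj (unipDeltaChar L e dV hdV dW hdW (S : Matrix (Fin 2) (Fin 2) L)
              (locToAdelic L e dV hdV dW hdW v
                ((y : ↥(unipDeltaLoc L e dV hdV dW hdW v)) : UnitaryGroup.localPi L (IsCMField.complexConj L) (2 + 2) (hermD L e dV hdV dW hdW) v)) : ℂ) *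
            f s (UnitaryGroup.evalPlace (Fp L) L (IsCMField.complexConj L) (2 + 2) (hermD L e dV hdV dW hdW) v
                  (UnitaryGroup.finPart (Fp L) L (IsCMField.complexConj L) (2 + 2) (hermD L e dV hdV dW hdW) (SiegelDoubled.weylDelta L e dV hdV dW hdW)) *
                ((y : ↥(unipDeltaLoc L e dV hdV dW hdW v)) : UnitaryGroup.localPi L (IsCMField.complexConj L) (2 + 2) (hermD L e dV hdV dW hdW) v) * g₀) ∂ν) ∧
      Differentiable ℂ fun s : ℂ =>
        ∫ y in kindWLocalBall L e dV hdV dW hdW v π (-(K : ℤ)),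
          conj (unipDeltaChar L e dV hdV dW hdW (S : Matrix (Fin 2) (Fin 2) L)
              (locToAdelic L e dV hdV dW hdW v
                ((y : ↥(unipDeltaLoc L e dV hdV dW hdW v)) : UnitaryGroup.localPi L (IsCMField.complexConj L) (2 + 2) (hermD L e dV hdV dW hdW) v)) : ℂ) *
            f s (UnitaryGroup.evalPlace (Fp L) L (IsCMField.complexConj L) (2 + 2) (hermD L e dV hdV dW hdW) v
                  (UnitaryGroup.finPart (Fp L) L (IsCMField.complexConj L) (2 + 2) (hermD L e dV hdV dW hdW) (SiegelDoubled.weylDelta L e dV hdV dW hdW)) *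
                ((y : ↥(unipDeltaLoc L e dV hdV dW hdW v)) : UnitaryGroup.localPi L (IsCMField.complexConj L) (2 + 2) (hermD L e dV hdV dW hdW) v) * g₀) ∂ν := by
  haveI : Algebra.IsQuadraticExtension (Fp L) L := IsCMField.isQuadraticExtension L
  -- ★ B4: `(w_Δ)_v` is the local Weyl element of the D10 frame
  rw [evalPlace_finPart_weylDelta]
  -- the Skew chart (★ `skewMatrices`, ★ B2) with its Borel σ-algebra; `ψc_*ν` is a regular additive Haar measure on the locally compact `Sk` (★ glue)
  obtain ⟨Sk, hSkdef⟩ : ∃ Sk : AddSubgroup (Matrix (Fin 2) (Fin 2) (LocalRing L v)),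
      Sk = skewMatrices (conjLocal L (IsCMField.complexConj L) v) (LocalSplitting.gramS (Fp L) L v 2 (gramR L e dV hdV dW hdW)) := ⟨_, rfl⟩
  have hSk : ∀ t, t ∈ Sk ↔ (t.map (conjLocal L (IsCMField.complexConj L) v))ᵀ * LocalSplitting.gramS (Fp L) L v 2 (gramR L e dV hdV dW hdW) +
      LocalSplitting.gramS (Fp L) L v 2 (gramR L e dV hdV dW hdW) * t = 0 := fun t => by
    rw [hSkdef]
    exact (mem_skewMatrices_iff _ _ t).trans (by rw [add_comm])
  letI : MeasurableSpace ↥Sk := borel _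
  haveI : BorelSpace ↥Sk := ⟨rfl⟩
  obtain ⟨ψc, hψc, -⟩ := exists_homeomorph_skew_of_carrier (F := Fp L) (E := L) (c := IsCMField.complexConj L) (v := v) (n := 2)
    (hJD := hermD_eq_map_gramD L e dV hdV dW hdW) (N' := unipDeltaLoc L e dV hdV dW hdW v) (hN' := mem_unipDeltaLoc_iff_mem_unipDeltaLocal L e dV hdV dW hdW v)
    (S := Sk) (hS := hSk)
  obtain ⟨hHaar, hReg, hLC⟩ := skewCarrier_measure_letters L e dV hdV dW hdW v Sk hSk ψc hψc ν
  -- the translated family `g ↦ f s (g·g₀)`: Siegel, one open level `g₀ U g₀⁻¹`, entire in `s`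
  obtain ⟨U', hU'mem⟩ : ∃ U' : Subgroup (UnitaryGroup.localPi L (IsCMField.complexConj L) (2 + 2) (hermD L e dV hdV dW hdW) v), ∀ k, k ∈ U' ↔ g₀⁻¹ * k * g₀ ∈ U :=
    ⟨U.comap (MulAut.conj g₀⁻¹).toMonoidHom, fun k => by rw [Subgroup.mem_comap, MulEquiv.coe_toMonoidHom, MulAut.conj_apply, inv_inv]⟩
  have hU' : IsOpen (U' : Set (UnitaryGroup.localPi L (IsCMField.complexConj L) (2 + 2) (hermD L e dV hdV dW hdW) v)) := by
    have hc : Continuous fun k : UnitaryGroup.localPi L (IsCMField.complexConj L) (2 + 2) (hermD L e dV hdV dW hdW) v => g₀⁻¹ * k * g₀ :=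
      (continuous_const.mul continuous_id).mul continuous_const
    have hset : (U' : Set (UnitaryGroup.localPi L (IsCMField.complexConj L) (2 + 2) (hermD L e dV hdV dW hdW) v)) =
        (fun k => g₀⁻¹ * k * g₀) ⁻¹' (U : Set (UnitaryGroup.localPi L (IsCMField.complexConj L) (2 + 2) (hermD L e dV hdV dW hdW) v)) :=
      Set.ext fun k => hU'mem k
    rw [hset]
    exact hU.preimage hc
  have hf' : ∀ s, IsLocalSiegelSection (Fp L) L (IsCMField.complexConj L) (complexConj_imagUnit L) (imagUnit_ne_zero L) (imagUnit_mul_self L) v 2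
      (gramR_isSymm L e dV hdV dW hdW) (hermD_eq_map_gramD L e dV hdV dW hdW) (fun w => χ.localComponent w.1) s
      ((fun (s : ℂ) (g : UnitaryGroup.localPi L (IsCMField.complexConj L) (2 + 2) (hermD L e dV hdV dW hdW) v) => f s (g * g₀)) s) := fun s p hp g => by
    show f s (p * g * g₀) = _ * f s (g * g₀)
    rw [mul_assoc]
    exact hf s p hp (g * g₀)
  have hf'U : ∀ s g k, k ∈ U' →
      (fun (s : ℂ) (g : UnitaryGroup.localPi L (IsCMField.complexConj L) (2 + 2) (hermD L e dV hdV dW hdW) v) => f s (g * g₀)) s (g * k) =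
        (fun (s : ℂ) (g : UnitaryGroup.localPi L (IsCMField.complexConj L) (2 + 2) (hermD L e dV hdV dW hdW) v) => f s (g * g₀)) s g := fun s g k hk => by
    show f s (g * k * g₀) = f s (g * g₀)
    have h1 : g * k * g₀ = g * g₀ * (g₀⁻¹ * k * g₀) := by group
    rw [h1]
    exact hfU s (g * g₀) _ ((hU'mem k).1 hk)
  have hf'd : ∀ g, Differentiable ℂ fun s =>
      (fun (s : ℂ) (g : UnitaryGroup.localPi L (IsCMField.complexConj L) (2 + 2) (hermD L e dV hdV dW hdW) v) => f s (g * g₀)) s g := fun g => hdiff (g * g₀)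
  obtain ⟨Kz, hstab, hhol⟩ := exists_setIntegral_skewBall_stable_and_differentiable L e dV hdV dW hdW hdV0 hdW0 v hπ Sk hSk (Measure.map ψc ν) χ hU' hf' hf'U hf'd S hdet
  -- the transport of every ball integral to the Skew carrier
  have transport : ∀ (s : ℂ) (a : ℤ),
      ∫ y in kindWLocalBall L e dV hdV dW hdW v π a,
          conj (unipDeltaChar L e dV hdV dW hdW (S : Matrix (Fin 2) (Fin 2) L)
              (locToAdelic L e dV hdV dW hdW v
                ((y : ↥(unipDeltaLoc L e dV hdV dW hdW v)) : UnitaryGroup.localPi L (IsCMField.complexConj L) (2 + 2) (hermD L e dV hdV dW hdW) v)) : ℂ) *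
            f s (LocalSplitting.weylDelta (Fp L) L (IsCMField.complexConj L) v 2 (hermD_eq_map_gramD L e dV hdV dW hdW) *
                ((y : ↥(unipDeltaLoc L e dV hdV dW hdW v)) : UnitaryGroup.localPi L (IsCMField.complexConj L) (2 + 2) (hermD L e dV hdV dW hdW) v) * g₀) ∂ν =
        ∫ t in {t : Sk | ∀ i j (w : PlacesOver L v), Valued.v (t.1 i j w) ≤ Valued.v (toPlace v w π) ^ a},
          f s (LocalSplitting.weylDelta (Fp L) L (IsCMField.complexConj L) v 2 (hermD_eq_map_gramD L e dV hdV dW hdW) *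
              nElem (Fp L) L (IsCMField.complexConj L) v 2 (hermD_eq_map_gramD L e dV hdV dW hdW) t.1 ((hSk t.1).1 t.2) * g₀) *
            ((adeleAddCharAt (Fp L) v (-(Algebra.trace (v.adicCompletion (Fp L)) (LocalRing L v)
              (Matrix.trace ((-(⅟(2 : LocalRing L v) • (S : Matrix (Fin 2) (Fin 2) L).map (algebraMap L (LocalRing L v)))) * t.1)))) : Circle) : ℂ)
              ∂(Measure.map ψc ν) := fun s a =>
    setIntegral_kindWLocalBall_eq_setIntegral_skew_tate L e dV hdV dW hdW v hπ Sk hSk ψc hψc ν (S : Matrix (Fin 2) (Fin 2) L)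
      (fun x => f s (LocalSplitting.weylDelta (Fp L) L (IsCMField.complexConj L) v 2 (hermD_eq_map_gramD L e dV hdV dW hdW) * x * g₀)) a
  refine ⟨Kz.toNat, fun s k hk => ?_, ?_⟩
  · have hK' : Kz ≤ ((Kz.toNat : ℕ) : ℤ) := Int.self_le_toNat Kz
    have hk' : Kz ≤ ((k : ℕ) : ℤ) := hK'.trans (by exact_mod_cast hk)
    rw [transport s (-(k : ℤ)), transport s (-(Kz.toNat : ℤ))]
    exact (hstab s (k : ℤ) hk').trans (hstab s (Kz.toNat : ℤ) hK').symm
  · -- holomorphy of the stable ball integral, read back along the transport (pointwise `congr`, no restatement)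
    exact fun s₁ => ((hhol (-(Kz.toNat : ℤ))) s₁).congr_of_eventuallyEq (Filter.Eventually.of_forall fun s => transport s (-(Kz.toNat : ℤ)))

end OnePlace

end Summit.HodgeConjecture.HodgeConjecture.Cruxes.HLiu418.K2LiuKindWFiniteStabilityLetters

end
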